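import Literature.InformationTheory.QuantumCodes.DistanceFailureFloor
import Literature.InformationTheory.QuantumCodes.SyndromeDecodingAdditive
import Literature.InformationTheory.QuantumCodes.DepolarizingCSSDecoding
import Literature.InformationTheory.QuantumCodes.LocalityBounds
import Literature.InformationTheory.QuantumCodes.Pauli
import HarnessLib

/-!
# The distance FLOOR for EVERY decoder of EVERY stabilizer code under depolarizing noise:
# `½·C(d,⌈d/2⌉)·(p/3)^{⌈d/2⌉}(1−p)^{⌊d/2⌋} ≤ P_fail`; a depolarizing threshold forces `d → ∞`

Topic `Literature/InformationTheory/QuantumCodes` (venture QEC, LADDER-QEC rungs Q4/Q5; qec-lit-2 gen 6). Theorem-only;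
no definition, no named fact, no `sorry`.

**Printed statement.** Dennis–Kitaev–Landahl–Preskill 2002, §3, for a general STABILIZER code: "The distance `d` of a
stabilizer code is the weight of the minimal-weight Pauli operator that preserves the code subspace and acts
nontrivially … In principle, `L/2` errors could suffice to cause damage to the encoded information"; §4.1: the
depolarizing channel applies `X`, `Y`, `Z` each with probability `p/3`; §4.3: recovery succeeds iff the net operation
is a stabilizer element. Gottesman 1997 §2.3: distance `≥ 2t+1` is needed to correct `t` errors. `DistanceFailureFloor.lean`
is the sector form for CSS codes (independent flips); this file is the GENERAL form, in the tree's binary symplectic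
vocabulary (`SymplecticCodes.lean`, `StabilizerDistance.lean`, `SyndromeDecodingAdditive.lean`, `Pauli.lean`):

* errors `v ∈ 𝔽₂ⁿ × 𝔽₂ⁿ` (`SympVec n`, Pauli word `toPauliString v`), depolarizing probability
  `depolarizingProb p (toPauliString v) = ∏ᵢ (1−p | p/3)` (`DepolarizingCSSDecoding.lean`); a decoder is ANY map
  `D : Decoder Syn (SympVec n)` of ANY syndrome map `syn` that is constant on cosets of `S̄⊥` (the genuine syndrome
  `sympSyndrome g` of generators `g` of `S̄` qualifies: `sympSyndrome_add_of_mem_sympDual`); success = the tree's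
  `D.Corrects syn S̄ v` (`D(syn v) + v ∈ S̄`); the failure probability is written inline as
  `Σ_{v : ¬ D.Corrects syn S̄ v} depolarizingProb p (toPauliString v)`.
* `not_corrects_and_corrects_add` — no decoder corrects both `v` and `v + L` for a logical `L ∈ S̄⊥ ∖ S̄` (same syndrome,
  the two net operations differ by `L`).
* **`distanceFloor_le_depolarizingFailure_of_logical`**: for every `L ∈ S̄⊥ ∖ S̄` of weight `w`, every such decoder and
  `0 ≤ p ≤ 3/4`: `½·C(w,⌈w/2⌉)·(p/3)^{⌈w/2⌉}(1−p)^{⌊w/2⌋} ≤ P_fail` — pair `v ↔ v + L` on the event "on `supp L` the word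
  of `v` uses only the letters of `L`, at least half of them": there `v + L` is at least as likely as `v` (`p/3 ≤ 1 − p`);
  **`distanceFloor_le_depolarizingFailure`**: the same with `w = minDistance S̄` (any `S̄` with a logical operator, i.e.
  `0 < minDistance S̄`; self-orthogonality is not even needed); cruder `half_pow_minDistance_le_depolarizingFailure`:
  `½·(p/3)^d ≤ P_fail`.
* FAMILIES (any decoders, any coset-constant syndrome maps): `0 < minDistance ≤ w` uniformly ⇒ no depolarizing rate
  `0 < p ≤ 3/4` is below threshold and the accuracy threshold is `0` (`depolarizing_accuracyThreshold_eq_zero_of_minDistance_le`);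
  **`tendsto_minDistance_atTop_of_depolarizing_belowThreshold`**: one below-threshold depolarizing rate for SOME decoder
  family forces `minDistance S̄_i → ∞`.

Scope: joint decoders included (no sector splitting); the floor uses only the letters of one minimum-weight logical, so it
is `(p/3)^{⌈d/2⌉}`, weaker than the sector-wise CSS bound `(2p/3)^{⌈d/2⌉}` of `DistanceFailureFloorDepolarizing.lean`, which
however covers sector-wise decoders only. Not claimed: anything sharper; phenomenological / circuit noise; numerics.

## References

* [DennisEtAl2002] E. Dennis, A. Kitaev, A. Landahl, J. Preskill, *Topological quantum memory*, J. Math. Phys. 43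
  (2002) 4452 = arXiv:quant-ph/0110143, §3 (chunk p0008 L5: distance of a stabilizer code; chunk p0010 L3: "L/2 errors
  could suffice to cause damage"), §4.1 (depolarizing channel), §4.3 (success iff the net operation is in the stabilizer;
  below threshold), §4.6 (`p_c`).
* [Gottesman1997] D. Gottesman, PhD thesis, arXiv:quant-ph/9705052, §2.3 ("to correct t errors … distance ≥ 2t+1"), §3.2
  (the error syndrome).
* [LinCostello2004] S. Lin, D. J. Costello, *Error Control Coding*, 2nd ed., §3.5 (smaller weight is more probable).

## Mathlib / tree search

Tree: `SympVec`, `sympDual`, `sympWeight`, `sympSupport`/`card_sympSupport` (LocalityBounds), `minDistance`,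
`exists_sympWeight_eq_minDistance`, `minDistance_pos_iff` (StabilizerDistance), `Decoder`, `Decoder.Corrects`
(SyndromeDecoding), `sympSyndrome`, `sympSyndrome_eq_iff` (SyndromeDecodingAdditive), `toPauliString`,
`toPauliString_eq_I_iff`, `equivPauliString` (Pauli), `depolarizingLetter`/`depolarizingProb` (DepolarizingCSSDecoding),
`Pauli.sum_univ` (PauliExpansion), `not_belowThreshold_of_le`, `accuracyThreshold_eq_zero_of_not_belowThreshold`
(DistanceFailureFloor). Mathlib: `Fintype.prod_sum`, `Fintype.sum_equiv`, `Equiv.sum_comp`, `Equiv.addRight`,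
`Finset.prod_mul_prod_compl`, `Finset.prod_ite`, `Finset.card_powersetCard`, `Finset.sum_comm`, `pow_le_pow_left`.
-/

namespace Literature.InformationTheory.QuantumCodes

open Finset Filter Topology Literature.Computability.QuantumComplexity

variable {n : ℕ}

/-! ### Letters of `v`, `L` and `v + L` -/

section Letters

/-- In `𝔽₂`: `a + a = 0`. [folklore] -/
private theorem zmod2_add_self (a : ZMod 2) : a + a = 0 := by
  revert a; decide

/-- Equal letters ↔ equal symplectic bits. [cite: CalderbankEtAl1998, §2 (printed p. 5: (a|b) ↔ X(a)Z(b))] -/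
theorem toPauliString_apply_eq_iff (v L : SympVec n) (i : Fin n) :
    toPauliString v i = toPauliString L i ↔ v.1 i = L.1 i ∧ v.2 i = L.2 i := by
  constructor
  · intro h
    have h1 := congrArg xBit h
    have h2 := congrArg zBit h
    simp only [toPauliString_apply, xBit_pauliLetter, zBit_pauliLetter] at h1 h2
    exact ⟨h1, h2⟩
  · rintro ⟨h1, h2⟩
    simp only [toPauliString_apply, h1, h2]

/-- The support of `L` is the set of its non-identity letters. [cite: CalderbankEtAl1998, §2 (printed p. 4: weight of (a|b))] -/
theorem mem_sympSupport_iff_ne_I (L : SympVec n) (i : Fin n) :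
    i ∈ sympSupport L ↔ toPauliString L i ≠ Pauli.I := by
  rw [Ne, toPauliString_eq_I_iff, not_and_or]
  simp [sympSupport]

/-- Where `v` is the identity, `v + L` has the letter of `L`. [cite: Gottesman1997, §3.2 (products of Pauli operators add their vectors)] -/
theorem toPauliString_add_of_eq_I {v : SympVec n} (L : SympVec n) {i : Fin n}
    (h : toPauliString v i = Pauli.I) : toPauliString (v + L) i = toPauliString L i := by
  rw [toPauliString_eq_I_iff] at h
  simp only [toPauliString_apply, Prod.fst_add, Prod.snd_add, Pi.add_apply, h.1, h.2, zero_add]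

/-- Where `v` has the letter of `L`, `v + L` is the identity. [cite: Gottesman1997, §3.2] -/
theorem toPauliString_add_of_eq {v L : SympVec n} {i : Fin n} (h : toPauliString v i = toPauliString L i) :
    toPauliString (v + L) i = Pauli.I := by
  rw [toPauliString_apply_eq_iff] at h
  rw [toPauliString_eq_I_iff]
  simp only [Prod.fst_add, Prod.snd_add, Pi.add_apply, h.1, h.2, zmod2_add_self, and_self]

/-- Off the support of `L`, `v + L` has the letters of `v`. [cite: Gottesman1997, §3.2] -/
theorem toPauliString_add_of_right_eq_I (v : SympVec n) {L : SympVec n} {i : Fin n}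
    (h : toPauliString L i = Pauli.I) : toPauliString (v + L) i = toPauliString v i := by
  rw [toPauliString_eq_I_iff] at h
  simp only [toPauliString_apply, Prod.fst_add, Prod.snd_add, Pi.add_apply, h.1, h.2, add_zero]

end Letters

/-! ### Depolarizing weights: letters, normalisation, restriction to a set of qubits -/

section Weights

/-- `Σ_P w(P) = (1 − p) + 3·(p/3) = 1`. [cite: DennisEtAl2002, §4.1 (depolarizing channel: X, Y, Z each with probability p/3)] -/
theorem sum_depolarizingLetter (p : ℝ) : ∑ P : Pauli, depolarizingLetter p P = 1 := by
  rw [Pauli.sum_univ]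
  simp [depolarizingLetter]
  ring

/-- The weight of a non-identity letter is `p/3`, of the identity `1 − p`. [cite: DennisEtAl2002, §4.1] -/
theorem depolarizingLetter_of_ne_I {p : ℝ} {P : Pauli} (h : P ≠ Pauli.I) : depolarizingLetter p P = p / 3 := by
  simp [depolarizingLetter, h]

/-- **Restriction identity** (product structure of the i.i.d. law): prescribing the letters on a set `T` of qubits and
summing over the rest, `Σ_{E : E|_T = F|_T} P(E) = ∏_{i ∈ T} w(F i)`.
[cite: DennisEtAl2002, §4.1 (errors on different qubits independent) and §4.4 eq. (prob_E)] -/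
theorem sum_depolarizingProb_restrict (p : ℝ) (T : Finset (Fin n)) (F : Fin n → Pauli) :
    ∑ E : Fin n → Pauli, (if ∀ i ∈ T, E i = F i then depolarizingProb p E else 0) =
      ∏ i ∈ T, depolarizingLetter p (F i) := by
  classical
  set g : Fin n → Pauli → ℝ := fun i P =>
    if i ∈ T then (if P = F i then depolarizingLetter p P else 0) else depolarizingLetter p P with hg
  have h := Fintype.prod_sum g
  -- left side of `h`
  have hL : ∀ i, ∑ P, g i P = if i ∈ T then depolarizingLetter p (F i) else 1 := by
    intro i
    by_cases hi : i ∈ T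
    · simp only [hg, hi, if_true]
      rw [Finset.sum_ite_eq' univ (F i) (depolarizingLetter p)]
      simp
    · simp only [hg, hi, if_false, sum_depolarizingLetter]
  -- right side of `h`
  have hR : ∀ E : Fin n → Pauli,
      ∏ i, g i (E i) = if ∀ i ∈ T, E i = F i then depolarizingProb p E else 0 := by
    intro E
    by_cases hE : ∀ i ∈ T, E i = F i
    · rw [if_pos hE, depolarizingProb]
      refine Finset.prod_congr rfl fun i _ => ?_
      by_cases hi : i ∈ T
      · simp only [hg, hi, if_true, hE i hi]
      · simp only [hg, hi, if_false]
    · rw [if_neg hE]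
      push Not at hE
      obtain ⟨i, hi, hne⟩ := hE
      exact Finset.prod_eq_zero (mem_univ i) (by simp only [hg, hi, if_true, if_neg hne])
  rw [Finset.prod_congr rfl fun i _ => hL i, Fintype.sum_congr _ _ hR, Finset.prod_ite_mem, univ_inter] at h
  exact h.symm

/-- The restriction identity on symplectic vectors (transport along `(a|b) ↦ X(a)Z(b)`).
[cite: DennisEtAl2002, §4.1 and §4.4 eq. (prob_E); CalderbankEtAl1998, §2 (printed p. 5: Ē ≃ Pauli words)] -/
theorem sum_depolarizingProb_toPauliString_restrict (p : ℝ) (T : Finset (Fin n)) (F : Fin n → Pauli) :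
    ∑ v : SympVec n, (if ∀ i ∈ T, toPauliString v i = F i then depolarizingProb p (toPauliString v) else 0) =
      ∏ i ∈ T, depolarizingLetter p (F i) := by
  rw [← sum_depolarizingProb_restrict p T F]
  exact Fintype.sum_equiv equivPauliString _ _ fun v => rfl

/-- On a set `T` where a word uses only the identity or non-identity letters as prescribed by membership in `J ⊆ T`,
the restricted weight is `(p/3)^{|J|} (1−p)^{|T|−|J|}`. [cite: DennisEtAl2002, §4.1 and §4.4] -/
theorem prod_depolarizingLetter_pattern (p : ℝ) {T J : Finset (Fin n)} (hJ : J ⊆ T) (L : SympVec n)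
    (hT : ∀ i ∈ T, toPauliString L i ≠ Pauli.I) :
    ∏ i ∈ T, depolarizingLetter p (if i ∈ J then toPauliString L i else Pauli.I) =
      (p / 3) ^ J.card * (1 - p) ^ (T.card - J.card) := by
  classical
  have h1 : ∀ i ∈ T, depolarizingLetter p (if i ∈ J then toPauliString L i else Pauli.I) =
      if i ∈ J then p / 3 else 1 - p := by
    intro i hi
    by_cases hiJ : i ∈ J
    · rw [if_pos hiJ, if_pos hiJ, depolarizingLetter_of_ne_I (hT i hi)]
    · rw [if_neg hiJ, if_neg hiJ]
      simp [depolarizingLetter]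
  rw [Finset.prod_congr rfl h1, Finset.prod_ite, Finset.prod_const, Finset.prod_const]
  have hf1 : T.filter (fun i => i ∈ J) = J := by
    ext i
    simp only [mem_filter, and_iff_right_iff_imp]
    exact fun h => hJ h
  have hf2 : (T.filter fun i => ¬ i ∈ J) = T \ J := by
    ext i
    simp
  rw [hf1, hf2, Finset.card_sdiff_of_subset hJ]

end Weights

/-! ### The pairing `v ↔ v + L` -/

section Pairing

variable {Syn : Type*}

/-- **No decoder corrects both `v` and `v + L`** when `L ∈ S̄⊥ ∖ S̄` and the syndrome map does not see `L`: the two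
net operations differ by the logical `L`. [cite: DennisEtAl2002, §4.3 (success iff the net operation is in the stabilizer); Gottesman1997, §3.2 (f(E_a) = f(E_b) iff E_a E_b ∈ N(S))] -/
theorem not_corrects_and_corrects_add (S : Submodule (ZMod 2) (SympVec n)) (D : Decoder Syn (SympVec n))
    (syn : SympVec n → Syn) {L : SympVec n} (hLS : L ∉ S) {v : SympVec n} (hsyn : syn (v + L) = syn v) :
    ¬ (D.Corrects syn (S : Set (SympVec n)) v ∧ D.Corrects syn (S : Set (SympVec n)) (v + L)) := by
  rintro ⟨h1, h2⟩
  unfold Decoder.Corrects at h1 h2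
  rw [hsyn, ← add_assoc] at h2
  have h3 : (D (syn v) + v + L) - (D (syn v) + v) ∈ S := S.sub_mem h2 h1
  rw [add_sub_cancel_left] at h3
  exact hLS h3

/-- **The genuine syndrome qualifies**: the syndrome of generators `g` of `S̄` is blind to `S̄⊥`:
`σ(v + L) = σ(v)` for `L ∈ S̄⊥`, `S̄ = span g`. [cite: Gottesman1997, §3.2 (chunk p0018 L113–115: f(E_a) = f(E_b) iff f(E_a E_b) = 0 iff E_a E_b ∈ N(S))] -/
theorem sympSyndrome_add_of_mem_sympDual {ι : Type*} (g : ι → SympVec n) {L : SympVec n}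
    (hL : L ∈ sympDual (Submodule.span (ZMod 2) (Set.range g))) (v : SympVec n) :
    sympSyndrome g (v + L) = sympSyndrome g v := by
  rw [sympSyndrome_eq_iff, add_sub_cancel_left]
  exact hL

/-- **Weight comparison on the half-pattern event.** If on `T = supp L` the word of `v` uses only the identity or the
letter of `L`, with at least half of the positions carrying the letter of `L`, then `v + L` (letters of `L` swapped
with identities on `T`, unchanged elsewhere) is at least as likely as `v` under depolarizing noise with `p/3 ≤ 1 − p`.
[cite: LinCostello2004, §3.5 (smaller weight is more probable); DennisEtAl2002, §4.1] -/
theorem depolarizingProb_le_depolarizingProb_add {p : ℝ} (hp0 : 0 ≤ p) (hp : p ≤ 3 / 4) {v L : SympVec n}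
    (hletters : ∀ i ∈ sympSupport L, toPauliString v i = Pauli.I ∨ toPauliString v i = toPauliString L i)
    (hhalf : (sympSupport L).card ≤ 2 * ((sympSupport L).filter fun i => toPauliString v i ≠ Pauli.I).card) :
    depolarizingProb p (toPauliString v) ≤ depolarizingProb p (toPauliString (v + L)) := by
  classical
  set T := sympSupport L with hTdef
  set A := T.filter (fun i => toPauliString v i ≠ Pauli.I) with hA
  set B := T.filter (fun i => ¬ toPauliString v i ≠ Pauli.I) with hB
  have hT : ∀ i ∈ T, toPauliString L i ≠ Pauli.I := fun i hi => (mem_sympSupport_iff_ne_I L i).1 hi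
  have hp3 : 0 ≤ p / 3 := by positivity
  have hq : 0 ≤ 1 - p := by linarith
  have hle : p / 3 ≤ 1 - p := by linarith
  -- off `T` the two words agree
  have hoff : ∏ i ∈ Tᶜ, depolarizingLetter p (toPauliString v i) =
      ∏ i ∈ Tᶜ, depolarizingLetter p (toPauliString (v + L) i) := by
    refine Finset.prod_congr rfl fun i hi => ?_
    rw [Finset.mem_compl, mem_sympSupport_iff_ne_I, not_not] at hi
    rw [toPauliString_add_of_right_eq_I v hi]
  have hoff0 : 0 ≤ ∏ i ∈ Tᶜ, depolarizingLetter p (toPauliString (v + L) i) :=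
    Finset.prod_nonneg fun i _ => depolarizingLetter_nonneg hp0 (by linarith) _
  -- on `T`: the word of `v`
  have honv : ∏ i ∈ T, depolarizingLetter p (toPauliString v i) = (p / 3) ^ A.card * (1 - p) ^ B.card := by
    have h1 : ∀ i ∈ T, depolarizingLetter p (toPauliString v i) =
        if toPauliString v i ≠ Pauli.I then p / 3 else 1 - p := by
      intro i _
      by_cases h : toPauliString v i ≠ Pauli.I
      · rw [if_pos h, depolarizingLetter_of_ne_I h]
      · rw [if_neg h]
        rw [not_not] at h
        rw [h]
        simp [depolarizingLetter]
    rw [Finset.prod_congr rfl h1, Finset.prod_ite, Finset.prod_const, Finset.prod_const]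
  -- on `T`: the word of `v + L`
  have honw : ∏ i ∈ T, depolarizingLetter p (toPauliString (v + L) i) = (1 - p) ^ A.card * (p / 3) ^ B.card := by
    have h1 : ∀ i ∈ T, depolarizingLetter p (toPauliString (v + L) i) =
        if toPauliString v i ≠ Pauli.I then 1 - p else p / 3 := by
      intro i hi
      by_cases h : toPauliString v i ≠ Pauli.I
      · rw [if_pos h]
        have hvi : toPauliString v i = toPauliString L i := (hletters i hi).resolve_left h
        rw [toPauliString_add_of_eq hvi]
        simp [depolarizingLetter]
      · rw [if_neg h]
        rw [not_not] at h
        rw [toPauliString_add_of_eq_I L h, depolarizingLetter_of_ne_I (hT i hi)]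
    rw [Finset.prod_congr rfl h1, Finset.prod_ite, Finset.prod_const, Finset.prod_const]
  -- compare
  have hAB : A.card + B.card = T.card := by
    rw [hA, hB]
    exact Finset.card_filter_add_card_filter_not _
  have hBA : B.card ≤ A.card := by omega
  obtain ⟨c, hc⟩ := Nat.exists_eq_add_of_le hBA
  have hcomp : (p / 3) ^ A.card * (1 - p) ^ B.card ≤ (1 - p) ^ A.card * (p / 3) ^ B.card := by
    rw [hc, pow_add, pow_add]
    have h1 : (p / 3) ^ c ≤ (1 - p) ^ c := pow_le_pow_left₀ hp3 hle c
    have h2 : 0 ≤ (p / 3) ^ B.card * (1 - p) ^ B.card := by positivity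
    nlinarith [h1, h2]
  unfold depolarizingProb
  rw [← Finset.prod_mul_prod_compl T, ← Finset.prod_mul_prod_compl T (fun i => depolarizingLetter p (toPauliString (v + L) i)),
    honv, honw, hoff]
  exact mul_le_mul_of_nonneg_right hcomp hoff0

open Classical in
/-- **Pairing bound.** For `L ∈ S̄⊥ ∖ S̄` invisible to the syndrome map, every decoder `D` and `0 ≤ p ≤ 3/4`: the
depolarizing probability of the half-pattern event is at most `2·P_fail[D]` (on that event `D` fails on `v` or on the
heavier-or-equal-probability partner `v + L`). [cite: DennisEtAl2002, §3 (chunk p0010 L3) and §4.3; Gottesman1997, §2.3] -/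
theorem sum_halfPattern_le_two_mul_depolarizingFailure (S : Submodule (ZMod 2) (SympVec n))
    (D : Decoder Syn (SympVec n)) (syn : SympVec n → Syn) {L : SympVec n} (hLS : L ∉ S)
    (hsyn : ∀ v, syn (v + L) = syn v) {p : ℝ} (hp0 : 0 ≤ p) (hp : p ≤ 3 / 4) :
    ∑ v : SympVec n, (if (∀ i ∈ sympSupport L, toPauliString v i = Pauli.I ∨ toPauliString v i = toPauliString L i) ∧
          (sympSupport L).card ≤ 2 * ((sympSupport L).filter fun i => toPauliString v i ≠ Pauli.I).card
        then depolarizingProb p (toPauliString v) else 0) ≤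
      2 * ∑ v ∈ univ.filter (fun v : SympVec n => ¬ D.Corrects syn (S : Set (SympVec n)) v),
        depolarizingProb p (toPauliString v) := by
  have hw0 : ∀ v : SympVec n, 0 ≤ depolarizingProb p (toPauliString v) :=
    fun v => depolarizingProb_nonneg hp0 (by linarith) _
  set H : SympVec n → Prop := fun v =>
    (∀ i ∈ sympSupport L, toPauliString v i = Pauli.I ∨ toPauliString v i = toPauliString L i) ∧
      (sympSupport L).card ≤ 2 * ((sympSupport L).filter fun i => toPauliString v i ≠ Pauli.I).card with hH
  set F : SympVec n → Prop := fun v => ¬ D.Corrects syn (S : Set (SympVec n)) v with hF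
  have hfail : ∑ v ∈ univ.filter (fun v : SympVec n => ¬ D.Corrects syn (S : Set (SympVec n)) v),
      depolarizingProb p (toPauliString v) = ∑ v : SympVec n, if F v then depolarizingProb p (toPauliString v) else 0 := by
    rw [Finset.sum_filter]
  rw [hfail]
  -- split the event along failure of `v`
  have hsplit : ∀ v : SympVec n, (if H v then depolarizingProb p (toPauliString v) else 0) =
      (if H v ∧ F v then depolarizingProb p (toPauliString v) else 0) +
        (if H v ∧ ¬ F v then depolarizingProb p (toPauliString v) else 0) := by
    intro v
    by_cases h1 : H v <;> by_cases h2 : F v <;> simp [h1, h2]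
  have hA : ∑ v : SympVec n, (if H v ∧ F v then depolarizingProb p (toPauliString v) else 0) ≤
      ∑ v : SympVec n, (if F v then depolarizingProb p (toPauliString v) else 0) :=
    Finset.sum_le_sum fun v _ => by
      by_cases h1 : H v <;> by_cases h2 : F v <;> simp [h1, h2, hw0 v]
  -- the partner of a corrected `v` on the event fails and is at least as likely
  have hB : ∑ v : SympVec n, (if H v ∧ ¬ F v then depolarizingProb p (toPauliString v) else 0) ≤
      ∑ v : SympVec n, (if F (v + L) then depolarizingProb p (toPauliString (v + L)) else 0) :=
    Finset.sum_le_sum fun v _ => by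
      by_cases h1 : H v ∧ ¬ F v
      · have hFL : F (v + L) := by
          intro hc
          have hv : D.Corrects syn (S : Set (SympVec n)) v := by
            have := h1.2
            rwa [hF, not_not] at this
          exact not_corrects_and_corrects_add S D syn hLS (hsyn v) ⟨hv, hc⟩
        rw [if_pos h1, if_pos hFL]
        exact depolarizingProb_le_depolarizingProb_add hp0 hp h1.1.1 h1.1.2
      · rw [if_neg h1]
        split_ifs
        · exact hw0 _
        · exact le_rfl
  have hC : ∑ v : SympVec n, (if F (v + L) then depolarizingProb p (toPauliString (v + L)) else 0) =
      ∑ v : SympVec n, (if F v then depolarizingProb p (toPauliString v) else 0) :=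
    Equiv.sum_comp (Equiv.addRight L) (fun u => if F u then depolarizingProb p (toPauliString u) else 0)
  rw [Finset.sum_congr rfl fun v _ => hsplit v, Finset.sum_add_distrib]
  linarith

end Pairing

/-! ### The probability of the half-pattern event -/

section HalfPattern

/-- Uniqueness of the pattern: if on `T` the word of `v` equals the `J`-restriction of the word of `L` (letters of `L` on
`J`, identity on `T ∖ J`), then `J` is the set of non-identity letters of `v` on `T`.
[cite: CalderbankEtAl1998, §2 (printed p. 4: weight = number of non-identity coordinates)] -/
theorem pattern_eq_filter {v L : SympVec n} {T J : Finset (Fin n)} (hJ : J ⊆ T)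
    (hT : ∀ i ∈ T, toPauliString L i ≠ Pauli.I)
    (hE : ∀ i ∈ T, toPauliString v i = if i ∈ J then toPauliString L i else Pauli.I) :
    J = T.filter fun i => toPauliString v i ≠ Pauli.I := by
  classical
  ext i
  simp only [mem_filter]
  constructor
  · intro hi
    refine ⟨hJ hi, ?_⟩
    rw [hE i (hJ hi), if_pos hi]
    exact hT i (hJ hi)
  · rintro ⟨hiT, hne⟩
    by_contra hiJ
    rw [hE i hiT, if_neg hiJ] at hne
    exact hne rfl

open Classical in
/-- **Lower bound for the half-pattern event**: it contains, disjointly, the `C(d,⌈d/2⌉)` exact patterns "letters of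
`L` on `J`, identity on `supp L ∖ J`" with `|J| = ⌈d/2⌉`, each of probability `(p/3)^{⌈d/2⌉}(1−p)^{⌊d/2⌋}`
(`d = wt L`, `0 ≤ p ≤ 1`). [cite: DennisEtAl2002, §3 (chunk p0010 L3: L/2 errors) and §4.4 eq. (prob_E)] -/
theorem choose_mul_pow_le_sum_halfPattern {p : ℝ} (hp0 : 0 ≤ p) (hp1 : p ≤ 1) (L : SympVec n) :
    ((sympWeight L).choose ((sympWeight L + 1) / 2) : ℝ) *
        ((p / 3) ^ ((sympWeight L + 1) / 2) * (1 - p) ^ (sympWeight L / 2)) ≤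
      ∑ v : SympVec n, (if (∀ i ∈ sympSupport L, toPauliString v i = Pauli.I ∨ toPauliString v i = toPauliString L i) ∧
          (sympSupport L).card ≤ 2 * ((sympSupport L).filter fun i => toPauliString v i ≠ Pauli.I).card
        then depolarizingProb p (toPauliString v) else 0) := by
  set T := sympSupport L with hTdef
  set d := sympWeight L with hd
  set c := (d + 1) / 2 with hc
  have hTd : T.card = d := card_sympSupport L
  have hT : ∀ i ∈ T, toPauliString L i ≠ Pauli.I := fun i hi => (mem_sympSupport_iff_ne_I L i).1 hi
  have hw0 : ∀ v : SympVec n, 0 ≤ depolarizingProb p (toPauliString v) := fun v => depolarizingProb_nonneg hp0 hp1 _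
  -- the exact patterns
  have hpat : ∀ J ∈ T.powersetCard c,
      ∑ v : SympVec n, (if ∀ i ∈ T, toPauliString v i = (if i ∈ J then toPauliString L i else Pauli.I)
        then depolarizingProb p (toPauliString v) else 0) = (p / 3) ^ c * (1 - p) ^ (d - c) := by
    intro J hJ
    rw [Finset.mem_powersetCard] at hJ
    rw [sum_depolarizingProb_toPauliString_restrict, prod_depolarizingLetter_pattern p hJ.1 L hT, hJ.2, hTd]
  have hsum : ∑ J ∈ T.powersetCard c, ∑ v : SympVec n,
      (if ∀ i ∈ T, toPauliString v i = (if i ∈ J then toPauliString L i else Pauli.I)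
        then depolarizingProb p (toPauliString v) else 0) =
      (d.choose c : ℝ) * ((p / 3) ^ c * (1 - p) ^ (d - c)) := by
    rw [Finset.sum_congr rfl hpat, Finset.sum_const, Finset.card_powersetCard, hTd, nsmul_eq_mul]
  have hdc : d - c = d / 2 := by omega
  rw [hdc] at hsum
  rw [← hsum, Finset.sum_comm]
  refine Finset.sum_le_sum fun v _ => ?_
  -- pointwise: at most one pattern matches, and then the event holds
  by_cases hex : ∃ J ∈ T.powersetCard c, ∀ i ∈ T, toPauliString v i = (if i ∈ J then toPauliString L i else Pauli.I)
  · obtain ⟨J, hJ, hEJ⟩ := hex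
    have hJ' := Finset.mem_powersetCard.1 hJ
    have hJeq := pattern_eq_filter hJ'.1 hT hEJ
    have hH : (∀ i ∈ T, toPauliString v i = Pauli.I ∨ toPauliString v i = toPauliString L i) ∧
        T.card ≤ 2 * (T.filter fun i => toPauliString v i ≠ Pauli.I).card := by
      refine ⟨fun i hi => ?_, ?_⟩
      · rw [hEJ i hi]
        by_cases hiJ : i ∈ J
        · rw [if_pos hiJ]; exact Or.inr rfl
        · rw [if_neg hiJ]; exact Or.inl rfl
      · rw [← hJeq, hJ'.2, hTd]
        omega
    rw [if_pos hH]
    rw [Finset.sum_eq_single_of_mem J hJ]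
    · rw [if_pos hEJ]
    · intro J' hJ' hne
      rw [if_neg]
      intro hEJ'
      have hJ'' := Finset.mem_powersetCard.1 hJ'
      exact hne ((pattern_eq_filter hJ''.1 hT hEJ').trans hJeq.symm)
  · have h0 : ∑ J ∈ T.powersetCard c, (if ∀ i ∈ T, toPauliString v i = (if i ∈ J then toPauliString L i else Pauli.I)
        then depolarizingProb p (toPauliString v) else 0) = 0 :=
      Finset.sum_eq_zero fun J hJ => if_neg fun hEJ => hex ⟨J, hJ, hEJ⟩
    rw [h0]
    split_ifs
    · exact hw0 v
    · exact le_rfl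

/-- `p^w`-type crude bound: `(p/3)^w ≤ C(w,⌈w/2⌉)·(p/3)^{⌈w/2⌉}(1−p)^{⌊w/2⌋}` for `p/3 ≤ 1 − p`. [folklore] -/
private theorem pow_le_choose_mul_pow_third {p : ℝ} (hp0 : 0 ≤ p) (hp : p ≤ 3 / 4) (w : ℕ) :
    (p / 3) ^ w ≤ (w.choose ((w + 1) / 2) : ℝ) * ((p / 3) ^ ((w + 1) / 2) * (1 - p) ^ (w / 2)) := by
  have hsplit : (p / 3) ^ w = (p / 3) ^ ((w + 1) / 2) * (p / 3) ^ (w / 2) := by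
    rw [← pow_add]
    congr 1
    omega
  have h1 : (p / 3) ^ (w / 2) ≤ (1 - p) ^ (w / 2) := pow_le_pow_left₀ (by positivity) (by linarith) _
  have h2 : (1 : ℝ) ≤ (w.choose ((w + 1) / 2) : ℝ) := by
    exact_mod_cast Nat.choose_pos (by omega)
  have h3 : 0 ≤ (p / 3) ^ ((w + 1) / 2) * (1 - p) ^ (w / 2) := by
    have : 0 ≤ 1 - p := by linarith
    positivity
  have h4 : 0 ≤ (p / 3) ^ ((w + 1) / 2) := by positivity
  rw [hsplit]
  nlinarith [mul_le_mul_of_nonneg_left h1 h4]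

end HalfPattern

/-! ### The floor for one stabilizer code -/

section OneCode

variable {Syn : Type*}

open Classical in
/-- **THE DISTANCE FLOOR, every logical.** For every subspace `S̄ ≤ 𝔽₂ⁿ × 𝔽₂ⁿ`, every `L ∈ S̄⊥ ∖ S̄` of weight `w`,
every syndrome map blind to `L` (`syn (v + L) = syn v`), EVERY decoder and depolarizing rate `0 ≤ p ≤ 3/4`:
`½·C(w,⌈w/2⌉)·(p/3)^{⌈w/2⌉}(1−p)^{⌊w/2⌋} ≤ P_fail[D]`. [cite: DennisEtAl2002, §3 (chunk p0008 L5, p0010 L3) and §4.1, §4.3; Gottesman1997, §2.3] -/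
theorem distanceFloor_le_depolarizingFailure_of_logical (S : Submodule (ZMod 2) (SympVec n))
    (D : Decoder Syn (SympVec n)) (syn : SympVec n → Syn) {L : SympVec n} (hLS : L ∉ S)
    (hsyn : ∀ v, syn (v + L) = syn v) {p : ℝ} (hp0 : 0 ≤ p) (hp : p ≤ 3 / 4) :
    1 / 2 * (((sympWeight L).choose ((sympWeight L + 1) / 2) : ℝ) *
        ((p / 3) ^ ((sympWeight L + 1) / 2) * (1 - p) ^ (sympWeight L / 2))) ≤
      ∑ v ∈ univ.filter (fun v : SympVec n => ¬ D.Corrects syn (S : Set (SympVec n)) v),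
        depolarizingProb p (toPauliString v) := by
  have h1 := choose_mul_pow_le_sum_halfPattern hp0 (by linarith) L
  have h2 := sum_halfPattern_le_two_mul_depolarizingFailure S D syn hLS hsyn hp0 hp
  linarith

open Classical in
/-- **THE DISTANCE FLOOR for every decoder of every stabilizer code under depolarizing noise.** For every
`S̄ ≤ 𝔽₂ⁿ × 𝔽₂ⁿ` with a logical operator (`0 < d`, `d = minDistance S̄`), every syndrome map blind to `S̄⊥`, EVERY
decoder and `0 ≤ p ≤ 3/4`: `½·C(d,⌈d/2⌉)·(p/3)^{⌈d/2⌉}(1−p)^{⌊d/2⌋} ≤ P_fail[D]` — "`L/2` errors could suffice".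
[cite: DennisEtAl2002, §3 (chunk p0008 L5, p0010 L3) and §4.1, §4.3; Gottesman1997, §2.3] -/
theorem distanceFloor_le_depolarizingFailure (S : Submodule (ZMod 2) (SympVec n)) (hd : 0 < minDistance S)
    (D : Decoder Syn (SympVec n)) (syn : SympVec n → Syn) (hsyn : ∀ v, ∀ L ∈ sympDual S, syn (v + L) = syn v)
    {p : ℝ} (hp0 : 0 ≤ p) (hp : p ≤ 3 / 4) :
    1 / 2 * (((minDistance S).choose ((minDistance S + 1) / 2) : ℝ) *
        ((p / 3) ^ ((minDistance S + 1) / 2) * (1 - p) ^ (minDistance S / 2))) ≤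
      ∑ v ∈ univ.filter (fun v : SympVec n => ¬ D.Corrects syn (S : Set (SympVec n)) v),
        depolarizingProb p (toPauliString v) := by
  obtain ⟨L, hL, hLS, hLd⟩ := exists_sympWeight_eq_minDistance ((minDistance_pos_iff S).1 hd)
  have h := distanceFloor_le_depolarizingFailure_of_logical S D syn hLS (fun v => hsyn v L hL) hp0 hp
  rw [hLd] at h
  exact h

open Classical in
/-- Cruder: `½·(p/3)^d ≤ P_fail[D]` for every decoder (`d = minDistance S̄ > 0`, `0 ≤ p ≤ 3/4`).
[cite: DennisEtAl2002, §3 (chunk p0010 L3) and §4.3] -/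
theorem half_pow_minDistance_le_depolarizingFailure (S : Submodule (ZMod 2) (SympVec n)) (hd : 0 < minDistance S)
    (D : Decoder Syn (SympVec n)) (syn : SympVec n → Syn) (hsyn : ∀ v, ∀ L ∈ sympDual S, syn (v + L) = syn v)
    {p : ℝ} (hp0 : 0 ≤ p) (hp : p ≤ 3 / 4) :
    1 / 2 * (p / 3) ^ minDistance S ≤
      ∑ v ∈ univ.filter (fun v : SympVec n => ¬ D.Corrects syn (S : Set (SympVec n)) v),
        depolarizingProb p (toPauliString v) := by
  have h1 := distanceFloor_le_depolarizingFailure S hd D syn hsyn hp0 hp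
  have h2 := pow_le_choose_mul_pow_third hp0 hp (minDistance S)
  linarith

open Classical in
/-- **Generator-syndrome form**: for generators `g` of `S̄ = span g`, every decoder of the genuine syndrome
`σ(v) = ((gᵢ, v))ᵢ` obeys the floor `½·C(d,⌈d/2⌉)·(p/3)^{⌈d/2⌉}(1−p)^{⌊d/2⌋} ≤ P_fail` (`d = minDistance S̄ > 0`,
`0 ≤ p ≤ 3/4`). [cite: DennisEtAl2002, §3 and §4.3; Gottesman1997, §3.2 (the error syndrome)] -/
theorem distanceFloor_le_depolarizingFailure_sympSyndrome {ι : Type*} (g : ι → SympVec n)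
    (hd : 0 < minDistance (Submodule.span (ZMod 2) (Set.range g)))
    (D : Decoder (ι → ZMod 2) (SympVec n)) {p : ℝ} (hp0 : 0 ≤ p) (hp : p ≤ 3 / 4) :
    1 / 2 * (((minDistance (Submodule.span (ZMod 2) (Set.range g))).choose
          ((minDistance (Submodule.span (ZMod 2) (Set.range g)) + 1) / 2) : ℝ) *
        ((p / 3) ^ ((minDistance (Submodule.span (ZMod 2) (Set.range g)) + 1) / 2) *
          (1 - p) ^ (minDistance (Submodule.span (ZMod 2) (Set.range g)) / 2))) ≤
      ∑ v ∈ univ.filter (fun v : SympVec n =>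
          ¬ D.Corrects (sympSyndrome g) (Submodule.span (ZMod 2) (Set.range g) : Set (SympVec n)) v),
        depolarizingProb p (toPauliString v) :=
  distanceFloor_le_depolarizingFailure _ hd D (sympSyndrome g) (fun v _ hL => sympSyndrome_add_of_mem_sympDual g hL v)
    hp0 hp

end OneCode

/-! ### Families: bounded distance ⇒ no depolarizing threshold; a threshold ⇒ `d → ∞` -/

section Families

variable {nq : ℕ → ℕ} (S : ∀ i, Submodule (ZMod 2) (SympVec (nq i))) {Syn : ℕ → Type*}
  (syn : ∀ i, SympVec (nq i) → Syn i) (D : ∀ i, Decoder (Syn i) (SympVec (nq i)))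

open Classical in
/-- **Bounded distance ⇒ no depolarizing threshold for ANY decoder family**: if every code of the family has a logical
operator and `minDistance S̄_i ≤ w`, no depolarizing rate `0 < p ≤ 3/4` is below threshold (`P_fail ≥ ½(p/3)^w`
uniformly). [cite: DennisEtAl2002, §4.3 (below threshold) and §3 (chunk p0010 L3)] -/
theorem not_belowThreshold_depolarizing_of_minDistance_le (hd : ∀ i, 0 < minDistance (S i))
    (hsyn : ∀ i v, ∀ L ∈ sympDual (S i), syn i (v + L) = syn i v) {w : ℕ} (hw : ∀ i, minDistance (S i) ≤ w)
    {p : ℝ} (hp0 : 0 < p) (hp : p ≤ 3 / 4) :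
    ¬ BelowThreshold (fun i p => ∑ v ∈ univ.filter (fun v : SympVec (nq i) =>
        ¬ (D i).Corrects (syn i) (S i : Set (SympVec (nq i))) v), depolarizingProb p (toPauliString v)) p := by
  refine not_belowThreshold_of_le (c := 1 / 2 * (p / 3) ^ w) (by positivity) fun i => ?_
  have h := half_pow_minDistance_le_depolarizingFailure (S i) (hd i) (D i) (syn i) (hsyn i) hp0.le hp
  have hmono : (p / 3) ^ w ≤ (p / 3) ^ minDistance (S i) :=
    pow_le_pow_of_le_one (by positivity) (by linarith) (hw i)
  linarith

open Classical in
/-- **Depolarizing accuracy threshold `0`** for every decoder family of a stabilizer family with logical operators and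
bounded distance. [cite: DennisEtAl2002, §4.6 (p_c) and §3 (chunk p0010 L3)] -/
theorem depolarizing_accuracyThreshold_eq_zero_of_minDistance_le (hd : ∀ i, 0 < minDistance (S i))
    (hsyn : ∀ i v, ∀ L ∈ sympDual (S i), syn i (v + L) = syn i v) {w : ℕ} (hw : ∀ i, minDistance (S i) ≤ w) :
    accuracyThreshold (fun i p => ∑ v ∈ univ.filter (fun v : SympVec (nq i) =>
        ¬ (D i).Corrects (syn i) (S i : Set (SympVec (nq i))) v), depolarizingProb p (toPauliString v)) = 0 :=
  accuracyThreshold_eq_zero_of_not_belowThreshold fun _ hp0 hp =>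
    not_belowThreshold_depolarizing_of_minDistance_le S syn D hd hsyn hw hp0 (by linarith)

open Classical in
/-- **A DEPOLARIZING THRESHOLD FORCES `d → ∞`.** If every code of a stabilizer family has a logical operator and SOME
decoder family (of syndrome maps blind to `S̄⊥`) is below threshold at SOME depolarizing rate `0 < p ≤ 3/4`, then
`minDistance S̄_i → ∞`. [cite: DennisEtAl2002, §4.3 (below threshold) and §3 (chunk p0008 L5, p0010 L3)] -/
theorem tendsto_minDistance_atTop_of_depolarizing_belowThreshold (hd : ∀ i, 0 < minDistance (S i))
    (hsyn : ∀ i v, ∀ L ∈ sympDual (S i), syn i (v + L) = syn i v) {p : ℝ} (hp0 : 0 < p) (hp : p ≤ 3 / 4)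
    (h : BelowThreshold (fun i p => ∑ v ∈ univ.filter (fun v : SympVec (nq i) =>
        ¬ (D i).Corrects (syn i) (S i : Set (SympVec (nq i))) v), depolarizingProb p (toPauliString v)) p) :
    Tendsto (fun i => minDistance (S i)) atTop atTop := by
  unfold BelowThreshold at h
  rw [tendsto_atTop]
  intro w
  have hc : (0 : ℝ) < 1 / 2 * (p / 3) ^ w := by positivity
  refine (h.eventually (gt_mem_nhds hc)).mono fun i hi => ?_
  by_contra hlt
  push Not at hlt
  have h1 := half_pow_minDistance_le_depolarizingFailure (S i) (hd i) (D i) (syn i) (hsyn i) hp0.le hp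
  have hmono : (p / 3) ^ w ≤ (p / 3) ^ minDistance (S i) :=
    pow_le_pow_of_le_one (by positivity) (by linarith) hlt.le
  have hi' : ∑ v ∈ univ.filter (fun v : SympVec (nq i) =>
      ¬ (D i).Corrects (syn i) (S i : Set (SympVec (nq i))) v), depolarizingProb p (toPauliString v) <
        1 / 2 * (p / 3) ^ w := hi
  linarith

end Families

end Literature.InformationTheory.QuantumCodes
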